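import Mathlib
import Literature.NumberTheory.Transcendental.KZCalculus
import Literature.NumberTheory.Transcendental.KZLogCalculusProofs
import Summits.KontsevichZagierPeriods.KontsevichZagierPeriods.Theorems.TorsionLogsNeronTorsionSectorStubHaarReps
import Summits.KontsevichZagierPeriods.KontsevichZagierPeriods.Theorems.TorsionLogsNeronTorsionSectorStubCellStepInst
import Summits.KontsevichZagierPeriods.KontsevichZagierPeriods.Theorems.TorsionLogsNeronTorsionSectorAssemblyRows
import Summits.KontsevichZagierPeriods.KontsevichZagierPeriods.Theorems.TorsionLogsNeronTorsionSectorAssemblyObjects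
import Summits.KontsevichZagierPeriods.KontsevichZagierPeriods.Theorems.TorsionLogsNeronTorsionSectorAssemblyDecomp
import Summits.KontsevichZagierPeriods.KontsevichZagierPeriods.Theorems.HurwitzMicroSectorsNormalFormPrincipleDilogExistsSimplexPiecesTwo
import Summits.KontsevichZagierPeriods.KontsevichZagierPeriods.Theorems.TorsionLogsNeronTorsionSectorStubCornerChartLower
import HarnessLib

/-!
# Crux `TorsionLogs.NeronTorsionSector` (stmt-KontsevichZagierPeriods-14500) — assembly, the interface representations

Helper for the lead's stub `stub_assembly` (line `registered`): EXISTENCE of the x-chart representations shared by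
the slices of the assembly — the diagonal half-cells `t_j = [{x (j+1) < x′ < x < x j}, h(x′)/(√f√f′)]`, the column-1
cells `c_j = [(x 2, x 1) × row j, same]` (row `0 = (x 1, ∞)`), the third-kind reps `θ_j = [row j, Qf/√f]` and the
constants `ℓ(v) = [(x 2, x 1), v/√f]` (`stub_haarReps`; `Qf` is continuous on the closed cells by
`asmRows_package`). [cite: KontsevichZagier2001, §1.1]
-/

noncomputable section

open Set MeasureTheory Filter Topology
open Literature.NumberTheory.Transcendental Literature.NumberTheory.Transcendental.KZ
open Literature.ModelTheory.ExponentialFields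
open Summit.KontsevichZagierPeriods.HyperbolicBloch.OffTetraSectorKernel (isSemialgebraic_logIvl exists_logRep)

-- `Summit.KontsevichZagierPeriods.KontsevichZagierPeriods.…` is the tree's mandated layout (single-conjunct summit).
set_option linter.dupNamespace false

namespace Summit.KontsevichZagierPeriods.KontsevichZagierPeriods.Cruxes.NeronTorsionSector.Translation

/-- **Existence of the interface representations** (see the module docstring). [cite: KontsevichZagier2001, §1.1] -/
theorem asmIface_exists :
    ∀ (g₂ g₃ e₁ L₁ : ℝ) (m : ℕ) (x y : ℕ → ℝ) (f yb sl τ Y3 Qf sl3 X33 Y33 Qf3 Pg G τ' : ℝ → ℝ),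
    (∀ t, f t = 4 * t ^ 3 - g₂ * t - g₃) → f e₁ = 0 → 0 < e₁ → (∀ t, e₁ < t → 0 < f t) →
    6 ≤ m → x m = e₁ →
    (∀ k, 1 ≤ k → k < m → e₁ < x k ∧ y k < 0) → (∀ k, 1 ≤ k → k < m → x (k + 1) < x k) →
    (∀ k, 1 ≤ k → k ≤ m → IsAlgebraic ℚ (x k)) →
    (∀ k, 1 ≤ k → k < m → IsAlgebraic ℚ (y k) ∧ y k ^ 2 = f (x k)) →
    IsAlgebraic ℚ g₂ → IsAlgebraic ℚ g₃ →
    L₁ = (12 * x 1 ^ 2 - g₂) / (2 * y 1) → x 2 = L₁ ^ 2 / 4 - 2 * x 1 → y 2 = -(y 1 + L₁ * (x 2 - x 1)) →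
    yb = (fun t => -Real.sqrt (f t)) →
    sl = (fun t => (4 * t ^ 2 + 4 * t * x 1 + 4 * x 1 ^ 2 - g₂) / (yb t + y 1)) →
    τ = (fun t => sl t ^ 2 / 4 - t - x 1) →
    Y3 = (fun t => -(yb t + sl t * (τ t - t))) →
    Qf = (fun t => sl t / 2 + Y3 t / (2 * τ t) - yb t / (2 * t)) →
    sl3 = (fun t => (4 * τ t ^ 2 + 4 * τ t * x 1 + 4 * x 1 ^ 2 - g₂) / (Y3 t + y 1)) →
    X33 = (fun t => sl3 t ^ 2 / 4 - τ t - x 1) →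
    Y33 = (fun t => -(Y3 t + sl3 t * (X33 t - τ t))) →
    Qf3 = (fun t => sl3 t / 2 + Y33 t / (2 * X33 t) - Y3 t / (2 * τ t)) →
    Pg = (fun t => 4 * (t + 2 * x 1) * y 1 - L₁ * (4 * t ^ 2 + 4 * t * x 1 + 4 * x 1 ^ 2 - g₂)
      + 4 * (t + 2 * x 1) * yb t) →
    G = (fun t => Pg t / (yb t + y 1) ^ 2 * Real.sqrt (t * X33 t) / τ t) →
    τ' = (fun t => Y3 t / yb t) →
    MeasureTheory.IntegrableOn (fun t => (Real.sqrt (f t))⁻¹) (Set.Ioi e₁) →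
    StrictMonoOn τ (Set.Ici (x 1)) → τ '' Set.Ioi (x 1) = Set.Ioo (x 2) (x 1) →
    (∀ k, 1 ≤ k → k + 2 ≤ m → StrictMonoOn τ (Set.Icc (x (k + 1)) (x k)) ∧
      τ '' Set.Ioo (x (k + 1)) (x k) = Set.Ioo (x (k + 2)) (x (k + 1)) ∧
      τ (x k) = x (k + 1) ∧ τ (x (k + 1)) = x (k + 2)) →
    StrictAntiOn τ (Set.Icc e₁ (x (m - 1))) → τ '' Set.Ioo e₁ (x (m - 1)) = Set.Ioo e₁ (x (m - 1)) →
    τ e₁ = x (m - 1) → τ (x (m - 1)) = e₁ →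
    ∃ (Tx C1 : ℕ → Literature.NumberTheory.Transcendental.KZ.IntegralRep 2)
      (C10 : Literature.NumberTheory.Transcendental.KZ.IntegralRep 2)
      (Θx : ℕ → Literature.NumberTheory.Transcendental.KZ.IntegralRep 1)
      (L1 : ℝ → Literature.NumberTheory.Transcendental.KZ.IntegralRep 1),
    (∀ j, 1 ≤ j → j < m → (Tx j).domain = {z | x (j + 1) < z 1 ∧ z 1 < z 0 ∧ z 0 < x j} ∧
      Set.EqOn (Tx j).integrand (fun z => (g₂ * z 1 + 2 * g₃) / (4 * (z 1) ^ 2) / (Real.sqrt (f (z 0)) * Real.sqrt (f (z 1)))) (Tx j).domain) ∧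
    (∀ j, 1 ≤ j → j < m → (C1 j).domain = {z | (x 2 < z 0 ∧ z 0 < x 1) ∧ x (j + 1) < z 1 ∧ z 1 < x j} ∧
      Set.EqOn (C1 j).integrand (fun z => (g₂ * z 1 + 2 * g₃) / (4 * (z 1) ^ 2) / (Real.sqrt (f (z 0)) * Real.sqrt (f (z 1)))) (C1 j).domain) ∧
    (C10.domain = {z | (x 2 < z 0 ∧ z 0 < x 1) ∧ x 1 < z 1} ∧
      Set.EqOn C10.integrand (fun z => (g₂ * z 1 + 2 * g₃) / (4 * (z 1) ^ 2) / (Real.sqrt (f (z 0)) * Real.sqrt (f (z 1)))) C10.domain) ∧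
    (∀ j, 1 ≤ j → j < m → (Θx j).domain = {t | x (j + 1) < t 0 ∧ t 0 < x j} ∧
      Set.EqOn (Θx j).integrand (fun t => Qf (t 0) / Real.sqrt (f (t 0))) (Θx j).domain) ∧
    (∀ v, IsAlgebraic ℚ v → (L1 v).domain = {t | x 2 < t 0 ∧ t 0 < x 1} ∧
      Set.EqOn (L1 v).integrand (fun t => v / Real.sqrt (f (t 0))) (L1 v).domain) := by
  intro g₂ g₃ e₁ L₁ m x y f yb sl τ Y3 Qf sl3 X33 Y33 Qf3 Pg G τ' hf he₁ he₁pos hfpos hm6 hxm hgLow hgDec hgAlg'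
    hgAlgy ag₂ ag₃ hL₁ hx2 hy2 hyb hsl hτ hY3 hQf hsl3 hX33 hY33 hQf3 hPg hG hτ' hInt hτmono0 hτimg0 hτcell hτfanti hτfimg
    hτe₁ hτm1
  have hx1 : e₁ < x 1 ∧ y 1 < 0 := hgLow 1 le_rfl (lt_of_lt_of_le (by norm_num) hm6)
  have h1m : 1 < m := lt_of_lt_of_le (by norm_num) hm6
  have h2m : 2 < m := lt_of_lt_of_le (by norm_num) hm6
  have h3m : 3 < m := lt_of_lt_of_le (by norm_num) hm6
  have hmm : m ≤ m := le_rfl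
  have hm1 : m - 1 + 1 = m := Nat.sub_add_cancel h1m.le
  have hm1lt : m - 1 < m := Nat.sub_lt (Nat.zero_lt_of_lt h1m) Nat.one_pos
  have h1m1 : 1 ≤ m - 1 := Nat.le_sub_one_of_lt h1m
  have hx1pos : 0 < x 1 := he₁pos.trans hx1.1
  have hx1alg : IsAlgebraic ℚ (x 1) := hgAlg' 1 le_rfl h1m.le
  have hy1 : IsAlgebraic ℚ (y 1) ∧ y 1 ^ 2 = f (x 1) := hgAlgy 1 le_rfl h1m
  have hx2low : e₁ < x 2 ∧ y 2 < 0 := hgLow 2 (by norm_num) h2m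
  have hx2pos : 0 < x 2 := he₁pos.trans hx2low.1
  have hx2alg : IsAlgebraic ℚ (x 2) := hgAlg' 2 (by norm_num) h2m.le
  have hx21 : x 2 < x 1 := hgDec 1 le_rfl h1m
  have he₁a : IsAlgebraic ℚ e₁ := by rw [← hxm]; exact hgAlg' m h1m.le hmm
  have hanti := asmDecomp_anti x m hgDec
  have hsanti := asmDecomp_strictAnti x m hgDec
  -- the row package (continuity of `Qf` on the closed cells)
  obtain ⟨-, -, -, -, hsemi, hrows, hfold⟩ := asmRows_package g₂ g₃ e₁ L₁ m x y f yb sl τ Y3 Qf sl3 X33 Y33 Qf3 Pg G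
    τ' hf he₁ he₁pos hfpos hm6 hxm hgLow hgDec hgAlg' hy1.2 hy1.1 ag₂ ag₃ hL₁ hx2 hy2 hyb hsl hτ hY3 hQf hsl3 hX33 hY33 hQf3
    hPg hG hτ' hτmono0 hτimg0 hτcell hτfanti hτfimg hτe₁ hτm1
  -- kernel bound and semialgebraicity
  set Cb : ℝ := |g₂| / (4 * e₁) + |g₃| / (2 * e₁ ^ 2) with hCb
  have hCbd : ∀ t, e₁ < t → |(g₂ * t + 2 * g₃) / (4 * t ^ 2)| ≤ Cb := by
    intro t ht
    have ht0 : 0 < t := he₁pos.trans ht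
    rw [abs_div, abs_of_pos (by positivity : (0:ℝ) < 4 * t ^ 2), hCb]
    calc |g₂ * t + 2 * g₃| / (4 * t ^ 2) ≤ (|g₂| * t + 2 * |g₃|) / (4 * t ^ 2) := by
            gcongr
            calc |g₂ * t + 2 * g₃| ≤ |g₂ * t| + |2 * g₃| := abs_add_le _ _
              _ = |g₂| * t + 2 * |g₃| := by rw [abs_mul, abs_mul, abs_of_pos ht0, abs_two]
      _ = |g₂| / (4 * t) + |g₃| / (2 * t ^ 2) := by field_simp; ring
      _ ≤ |g₂| / (4 * e₁) + |g₃| / (2 * e₁ ^ 2) := by gcongr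
  have hIoiσ : IsSemialgebraic ℚ {p : Fin 1 → ℝ | p 0 ∈ Set.Ioi e₁} := isSemialgebraic_setOf_const_lt_apply he₁a 0
  have hkσ : IsSemialgebraicFunOn ℚ {p : Fin 1 → ℝ | p 0 ∈ Set.Ioi e₁} (fun p => (g₂ * p 0 + 2 * g₃) / (4 * p 0 ^ 2)) :=
    cellStep_isSemialgebraicFunOn_kernel hIoiσ ag₂ ag₃ fun p hp => (he₁pos.trans hp).ne'
  have hkc : ContinuousOn (fun t => (g₂ * t + 2 * g₃) / (4 * t ^ 2)) (Set.Ioi e₁) :=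
    ContinuousOn.div (by fun_prop) (by fun_prop) fun t ht => by have : 0 < t := he₁pos.trans ht; positivity
  have h2D := stub_haarReps.2
  have h1D := stub_haarReps.1
  -- plane reps on a semialgebraic `S ⊆ (e₁,∞)²`
  have hplane : ∀ S : Set (Fin 2 → ℝ), IsSemialgebraic ℚ S → S ⊆ {z | e₁ < z 0 ∧ e₁ < z 1} →
      ∃ r : IntegralRep 2, r.domain = S ∧ Set.EqOn r.integrand (fun z => (g₂ * z 1 + 2 * g₃) / (4 * (z 1) ^ 2) / (Real.sqrt (f (z 0)) * Real.sqrt (f (z 1)))) r.domain := by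
    intro S hS hSsub
    obtain ⟨r, hd, hi⟩ := h2D g₂ g₃ e₁ Cb f (fun t => (g₂ * t + 2 * g₃) / (4 * t ^ 2)) (Set.Ioi e₁) S ag₂ ag₃ he₁a hf
      hfpos hInt subset_rfl hIoiσ hkσ hkc (fun t ht => hCbd t ht) hS (fun z hz => ⟨(hSsub hz).1, (hSsub hz).2⟩)
    exact ⟨r, hd, fun z _ => by rw [hi]⟩
  have hxk_gt : ∀ k, 1 ≤ k → k ≤ m → ∀ t, x k < t → e₁ < t := fun k hk hkm t ht =>
    lt_of_le_of_lt (hxm.symm.le.trans (hanti k m hk hkm hmm)) ht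
  -- `Tx`
  have hTx : ∀ j, ∃ r : IntegralRep 2, 1 ≤ j → j < m →
      r.domain = {z | x (j + 1) < z 1 ∧ z 1 < z 0 ∧ z 0 < x j} ∧ Set.EqOn r.integrand (fun z => (g₂ * z 1 + 2 * g₃) / (4 * (z 1) ^ 2) / (Real.sqrt (f (z 0)) * Real.sqrt (f (z 1)))) r.domain := by
    intro j
    by_cases h : 1 ≤ j ∧ j < m
    · obtain ⟨r, hd, hi⟩ := hplane _
        (HurwitzMicroSectors.NormalFormPrinciple.PiBox.Dilog.spB_isSemialgebraic_triangle (hgAlg' (j + 1)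
          (Nat.le_add_left 1 j) h.2) (hgAlg' j h.1 h.2.le)) fun z hz =>
            ⟨(hxk_gt (j + 1) (Nat.le_add_left 1 j) h.2 _ hz.1).trans hz.2.1, hxk_gt (j + 1) (Nat.le_add_left 1 j) h.2 _ hz.1⟩
      exact ⟨r, fun _ _ => ⟨hd, hi⟩⟩
    · obtain ⟨r, -⟩ := hplane _ (asmObj_isSemialgebraic_quadrant he₁a) subset_rfl
      exact ⟨r, fun h1 h2 => absurd ⟨h1, h2⟩ h⟩
  choose Tx hTx using hTx
  -- `C1`
  have hC1 : ∀ j, ∃ r : IntegralRep 2, 1 ≤ j → j < m →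
      r.domain = {z | (x 2 < z 0 ∧ z 0 < x 1) ∧ x (j + 1) < z 1 ∧ z 1 < x j} ∧ Set.EqOn r.integrand (fun z => (g₂ * z 1 + 2 * g₃) / (4 * (z 1) ^ 2) / (Real.sqrt (f (z 0)) * Real.sqrt (f (z 1)))) r.domain := by
    intro j
    by_cases h : 1 ≤ j ∧ j < m
    · obtain ⟨r, hd, hi⟩ := hplane _ (asmObj_isSemialgebraic_rect hx2alg hx1alg (hgAlg' (j + 1) (Nat.le_add_left 1 j) h.2)
        (hgAlg' j h.1 h.2.le)) fun z hz => ⟨hx2low.1.trans hz.1.1, hxk_gt (j + 1) (Nat.le_add_left 1 j) h.2 _ hz.2.1⟩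
      exact ⟨r, fun _ _ => ⟨hd, hi⟩⟩
    · obtain ⟨r, -⟩ := hplane _ (asmObj_isSemialgebraic_quadrant he₁a) subset_rfl
      exact ⟨r, fun h1 h2 => absurd ⟨h1, h2⟩ h⟩
  choose C1 hC1 using hC1
  -- `C10`
  obtain ⟨C10, hC10d, hC10i⟩ := hplane _ (asmObj_isSemialgebraic_rectIoi hx2alg hx1alg hx1alg)
    fun z hz => ⟨hx2low.1.trans hz.1.1, hx1.1.trans hz.2⟩
  -- line reps on a row for functions continuous on the closed cell
  have hrowσ : ∀ j, 1 ≤ j → j < m → IsSemialgebraic ℚ {p : Fin 1 → ℝ | p 0 ∈ Set.Ioo (x (j + 1)) (x j)} :=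
    fun j hj hjm => isSemialgebraic_logIvl (hgAlg' (j + 1) (Nat.le_add_left 1 j) hjm) (hgAlg' j hj hjm.le)
  have hrowRep : ∀ j, 1 ≤ j → j < m → ∀ g : ℝ → ℝ, ContinuousOn g (Set.Icc (x (j + 1)) (x j)) →
      IsSemialgebraicFunOn ℚ {p : Fin 1 → ℝ | p 0 ∈ Set.Ioo (x (j + 1)) (x j)} (fun p => g (p 0)) →
      ∃ r : IntegralRep 1, r.domain = {t | x (j + 1) < t 0 ∧ t 0 < x j} ∧
        Set.EqOn r.integrand (fun t => g (t 0) / Real.sqrt (f (t 0))) r.domain := by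
    intro j hj hjm g hgc hgσ
    obtain ⟨M, hM⟩ := (isCompact_Icc.image_of_continuousOn hgc).isBounded.subset_closedBall_lt 0 0
    obtain ⟨r, hd, hi⟩ := h1D g₂ g₃ e₁ M f g (Set.Ioo (x (j + 1)) (x j)) ag₂ ag₃ he₁a hf hfpos hInt
      (fun t ht => hxk_gt (j + 1) (Nat.le_add_left 1 j) hjm t ht.1) (hrowσ j hj hjm) hgσ
      (hgc.mono Ioo_subset_Icc_self) fun t ht => by
        have := hM.2 ⟨t, Ioo_subset_Icc_self ht, rfl⟩
        rw [Metric.mem_closedBall, dist_zero_right, Real.norm_eq_abs] at this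
        exact this
    exact ⟨r, hd, fun t _ => by rw [hi]⟩
  have hQfcj : ∀ j, 1 ≤ j → j < m → ContinuousOn Qf (Set.Icc (x (j + 1)) (x j)) := by
    intro j hj hjm
    rcases Nat.lt_or_ge (j + 1) m with h | h
    · exact (hrows j hj h).2.2.1
    · have : j + 1 = m := le_antisymm hjm h
      rw [this, hxm, show j = m - 1 from by rw [← this, Nat.add_sub_cancel]]; exact hfold.2.1
  -- `Θx`
  have hΘx : ∀ j, ∃ r : IntegralRep 1, 1 ≤ j → j < m →
      r.domain = {t | x (j + 1) < t 0 ∧ t 0 < x j} ∧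
        Set.EqOn r.integrand (fun t => Qf (t 0) / Real.sqrt (f (t 0))) r.domain := by
    intro j
    by_cases h : 1 ≤ j ∧ j < m
    · obtain ⟨r, hd, hi⟩ := hrowRep j h.1 h.2 Qf (hQfcj j h.1 h.2) (hsemi _ (hrowσ j h.1 h.2)).2.1
      exact ⟨r, fun _ _ => ⟨hd, hi⟩⟩
    · obtain ⟨r, -⟩ := hrowRep 1 le_rfl h1m Qf (hQfcj 1 le_rfl h1m) (hsemi _ (hrowσ 1 le_rfl h1m)).2.1
      exact ⟨r, fun h1 h2 => absurd ⟨h1, h2⟩ h⟩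
  choose Θx hΘx using hΘx
  -- `L1`
  have hL1 : ∀ v, ∃ r : IntegralRep 1, IsAlgebraic ℚ v →
      r.domain = {t | x 2 < t 0 ∧ t 0 < x 1} ∧ Set.EqOn r.integrand (fun t => v / Real.sqrt (f (t 0))) r.domain := by
    intro v
    by_cases hv : IsAlgebraic ℚ v
    · obtain ⟨r, hd, hi⟩ := hrowRep 1 le_rfl h1m (fun _ => v) continuousOn_const
        (isSemialgebraicFunOn_const_of_isAlgebraic (hrowσ 1 le_rfl h1m) hv)
      exact ⟨r, fun _ => ⟨hd, hi⟩⟩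
    · obtain ⟨r, -⟩ := hrowRep 1 le_rfl h1m Qf (hQfcj 1 le_rfl h1m) (hsemi _ (hrowσ 1 le_rfl h1m)).2.1
      exact ⟨r, fun h => absurd h hv⟩
  choose L1 hL1 using hL1
  exact ⟨Tx, C1, C10, Θx, L1, hTx, hC1, ⟨hC10d, hC10i⟩, hΘx, hL1⟩

end Summit.KontsevichZagierPeriods.KontsevichZagierPeriods.Cruxes.NeronTorsionSector.Translation
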